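import Mathlib.Data.List.Chain
import Mathlib.Data.List.Nodup
import Mathlib.Data.Finset.Card
import Mathlib.Data.Fintype.Basic
import Mathlib.Logic.Relation
import HarnessLib

/-!
# The digraph of a bipartite graph with the diagonal perfect matching: arcs, dipaths, strong connectivity

Topic `Combinatorics/SimpleGraph`; two definitions (`IsArc`, `IsStrong`) and their basic API.
Tools for the hard direction of Little's theorem
(`Little1975_isPfaffianBipartite_iff_not_isMatchingMinor`, `LittleTheorem.lean`), which after the
reduction of `LittleTheoremReduction.lean` deals with a bipartite graph `G ⊆ Fin n × Fin n`
(edge-set encoding, rows × columns) CONTAINING THE DIAGONAL perfect matching. Robertson–Seymour–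
Thomas (1999, §7) and Little (1975, §2: the digraph `G_f`) associate with `(G, M)` the digraph
`D(G, M)`: contract every edge of `M`, direct the other edges from rows to columns. With `M` the
diagonal, `D(G, M)` has vertex set `Fin n` and an arc `x → y` for every off-diagonal edge
`(x, y) ∈ G` (`IsArc G x y`); its directed circuits are the cyclic permutations inside `G`
(`PfaffianDicycles.lean`), its dipaths are the `M`-alternating paths of `G` from a column to a row,
and `G` is matching covered and connected iff `D(G, M)` is strongly connected (`IsStrong`,
Robertson–Seymour–Thomas 7.5).

* `IsArc G x y := x ≠ y ∧ (x, y) ∈ G`, `IsStrong G := ∀ x y, ReflTransGen (IsArc G) x y`;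
* monotonicity and the arcs of `G.erase e`;
* dipaths as vertex lists: `List.IsChain (IsArc G) l`, and **from reachability to a directed
  PATH** (a chain without repeated vertices, `exists_isChain_nodup_of_reflTransGen`, for any
  relation);
* out-neighbours from row degrees: with the diagonal present, a row of degree `≥ 3` has two
  distinct out-neighbours (`exists_two_isArc_of_three_le_card`), and every out-arc has a
  companion (`exists_isArc_ne_of_three_le_card`); the same for in-arcs and column degrees.

## References

* N. Robertson, P. D. Seymour, R. Thomas, *Permanents, Pfaffian orientations, and even directed
  circuits*, Ann. of Math. 150 (1999) 929–975, §7 (the digraph `D(G, M)`, 7.4, 7.5).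
  [RobertsonSeymourThomas1999]
* C. H. C. Little, *A characterization of convertible (0,1)-matrices*, J. Combin. Theory Ser. B
  18 (1975) 187–208, §2 (the digraph `G_f`, Lemma 2). [Little1975]
-/

namespace Literature.Combinatorics.SimpleGraph

open Finset

/-! ### From reachability to directed paths (any relation) -/

section Paths

variable {α : Type*} {r : α → α → Prop}

/-- **A reachable vertex is reachable along a path**: if `b` is reachable from `a` in the
reflexive–transitive closure of `r`, there is an `r`-chain from `a` to `b` WITHOUT REPEATED
VERTICES. [folklore] -/
theorem exists_isChain_nodup_of_reflTransGen [DecidableEq α] {a b : α}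
    (h : Relation.ReflTransGen r a b) :
    ∃ l : List α, (a :: l).IsChain r ∧ (a :: l).Nodup ∧ (a :: l).getLast (List.cons_ne_nil _ _) = b := by
  induction h using Relation.ReflTransGen.head_induction_on with
  | refl => exact ⟨[], List.isChain_singleton _, List.nodup_singleton _, rfl⟩
  | @head a' c hac _ ih =>
    obtain ⟨l, hchain, hnodup, hlast⟩ := ih
    by_cases ha : a' ∈ c :: l
    · -- cut the walk at the (unique) occurrence of `a'`
      obtain ⟨i, hi, hia⟩ := List.getElem_of_mem ha
      have hne : (c :: l).drop i ≠ [] := by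
        simp only [ne_eq, List.drop_eq_nil_iff, not_le]; exact hi
      have hdrop : (c :: l).drop i = a' :: ((c :: l).drop (i + 1)) := by
        rw [List.drop_eq_getElem_cons hi, hia]
      refine ⟨(c :: l).drop (i + 1), ?_, ?_, ?_⟩
      · rw [← hdrop]; exact hchain.drop i
      · rw [← hdrop]; exact hnodup.sublist (List.drop_sublist _ _)
      · have h1 : (a' :: (c :: l).drop (i + 1)).getLast (List.cons_ne_nil _ _) =
            ((c :: l).drop i).getLast hne := by simp only [hdrop]
        rw [h1, List.getLast_drop, hlast]
    · exact ⟨c :: l, List.IsChain.cons_cons hac hchain, List.nodup_cons.2 ⟨ha, hnodup⟩,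
        by rw [List.getLast_cons_cons]; exact hlast⟩

/-- A chain from `a` ending at `b` witnesses reachability. [folklore] -/
theorem reflTransGen_of_isChain_cons {a b : α} {l : List α} (h : (a :: l).IsChain r)
    (hb : (a :: l).getLast (List.cons_ne_nil _ _) = b) : Relation.ReflTransGen r a b :=
  List.relationReflTransGen_of_exists_isChain_cons l h hb

/-- Consecutive elements of a chain are related. [folklore] -/
theorem rel_of_isChain_of_getElem {l : List α} (h : l.IsChain r) {i : ℕ} (hi : i + 1 < l.length) :
    r (l[i]'(Nat.lt_of_succ_lt hi)) (l[i + 1]'hi) :=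
  (List.isChain_iff_getElem.1 h) i hi

end Paths

/-! ### The digraph `D(G, diagonal)` -/

section Digraph

variable {n : ℕ}

/-- **The arcs of `D(G, M)` for the diagonal matching `M`**: an arc `x → y` for every
off-diagonal edge `(x, y)` (row `x`, column `y`) of `G` (Robertson–Seymour–Thomas 1999, §7:
direct every edge from rows to columns and contract the matching; Little 1975: the digraph
`G_f`). [cite: RobertsonSeymourThomas1999, §7 (the digraph D(G,M))] -/
def IsArc (G : Finset (Fin n × Fin n)) (x y : Fin n) : Prop := x ≠ y ∧ (x, y) ∈ G

/-- `IsArc G` is decidable (a conjunction of decidable propositions). [folklore] -/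
instance (G : Finset (Fin n × Fin n)) : DecidableRel (IsArc G) := fun _ _ =>
  inferInstanceAs (Decidable (_ ∧ _))

/-- **Strong connectivity of `D(G, M)`**: every vertex reaches every vertex along arcs. For the
diagonal matching this says that `G` is connected and matching covered (Robertson–Seymour–Thomas
1999, 7.5 with `k = 1`; Little 1975, Lemma 2). [cite: RobertsonSeymourThomas1999, (7.5)] -/
def IsStrong (G : Finset (Fin n × Fin n)) : Prop :=
  ∀ x y : Fin n, Relation.ReflTransGen (IsArc G) x y

variable {G G' : Finset (Fin n × Fin n)}

/-- Unfolding `IsArc`. [folklore] -/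
theorem isArc_iff {x y : Fin n} : IsArc G x y ↔ x ≠ y ∧ (x, y) ∈ G := Iff.rfl

/-- Arcs are monotone in `G`. [folklore] -/
theorem IsArc.mono {x y : Fin n} (h : IsArc G x y) (hGG' : G ⊆ G') : IsArc G' x y :=
  ⟨h.1, hGG' h.2⟩

/-- Reachability is monotone in `G`. [folklore] -/
theorem reflTransGen_isArc_mono {x y : Fin n} (h : Relation.ReflTransGen (IsArc G) x y)
    (hGG' : G ⊆ G') : Relation.ReflTransGen (IsArc G') x y := by
  induction h with
  | refl => exact Relation.ReflTransGen.refl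
  | tail _ hbc ih => exact ih.tail (hbc.mono hGG')

/-- Strong connectivity is monotone in `G`. [folklore] -/
theorem IsStrong.mono (h : IsStrong G) (hGG' : G ⊆ G') : IsStrong G' :=
  fun x y => reflTransGen_isArc_mono (h x y) hGG'

/-- The arcs after deleting the edge `e`. [folklore] -/
theorem isArc_erase_iff {e : Fin n × Fin n} {x y : Fin n} :
    IsArc (G.erase e) x y ↔ IsArc G x y ∧ (x, y) ≠ e := by
  simp only [IsArc, Finset.mem_erase, ne_eq]
  tauto

/-- Chains transfer along inclusions of the arc relation. [folklore] -/
theorem isChain_isArc_mono {l : List (Fin n)} (h : l.IsChain (IsArc G)) (hGG' : G ⊆ G') :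
    l.IsChain (IsArc G') :=
  List.IsChain.imp (fun _ _ ha => ha.mono hGG') h

/-- A chain of `G` avoiding the arc `e` (as a pair of consecutive vertices) is a chain of
`G.erase e`. [folklore] -/
theorem isChain_isArc_erase {e : Fin n × Fin n} {l : List (Fin n)} (h : l.IsChain (IsArc G))
    (he : ∀ i (hi : i + 1 < l.length), (l[i]'(Nat.lt_of_succ_lt hi), l[i + 1]'hi) ≠ e) :
    l.IsChain (IsArc (G.erase e)) := by
  rw [List.isChain_iff_getElem] at h ⊢
  intro i hi
  exact isArc_erase_iff.2 ⟨h i hi, he i hi⟩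

/-- **In a strongly connected digraph every ordered pair is joined by a directed path** (no
repeated vertices). [folklore] -/
theorem IsStrong.exists_path (h : IsStrong G) (x y : Fin n) :
    ∃ l : List (Fin n), (x :: l).IsChain (IsArc G) ∧ (x :: l).Nodup ∧
      (x :: l).getLast (List.cons_ne_nil _ _) = y :=
  exists_isChain_nodup_of_reflTransGen (h x y)

/-! ### Out- and in-neighbours from degrees -/

/-- The out-neighbours of `x` in `D(G, M)`: the columns `y ≠ x` with `(x, y) ∈ G`. [folklore] -/
theorem mem_filter_isArc_iff (x y : Fin n) :
    y ∈ Finset.univ.filter (fun y => IsArc G x y) ↔ IsArc G x y := by simp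

/-- With the diagonal edge present, the out-degree of `x` in `D(G, M)` is the row degree of `x`
minus one. [folklore] -/
theorem card_filter_isArc_out (x : Fin n) (hx : (x, x) ∈ G) :
    (Finset.univ.filter fun y => IsArc G x y).card + 1 = (G.filter fun e => e.1 = x).card := by
  classical
  have h1 : (G.filter fun e => e.1 = x) =
      insert (x, x) ((Finset.univ.filter fun y => IsArc G x y).image fun y => (x, y)) := by
    ext ⟨a, b⟩
    simp only [Finset.mem_filter, Finset.mem_insert, Finset.mem_image, Finset.mem_univ, true_and,
      Prod.mk.injEq, IsArc]
    constructor
    · rintro ⟨hab, rfl⟩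
      by_cases hb : b = a
      · exact Or.inl ⟨rfl, hb⟩
      · exact Or.inr ⟨b, ⟨Ne.symm hb, hab⟩, rfl, rfl⟩
    · rintro (⟨rfl, rfl⟩ | ⟨y, ⟨-, hy⟩, rfl, rfl⟩)
      · exact ⟨hx, rfl⟩
      · exact ⟨hy, rfl⟩
  rw [h1, Finset.card_insert_of_notMem, Finset.card_image_of_injective]
  · intro y y' h; exact (Prod.ext_iff.1 h).2
  · simp [IsArc]

/-- With the diagonal edge present, the in-degree of `y` in `D(G, M)` is the column degree of `y`
minus one. [folklore] -/
theorem card_filter_isArc_in (y : Fin n) (hy : (y, y) ∈ G) :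
    (Finset.univ.filter fun x => IsArc G x y).card + 1 = (G.filter fun e => e.2 = y).card := by
  classical
  have h1 : (G.filter fun e => e.2 = y) =
      insert (y, y) ((Finset.univ.filter fun x => IsArc G x y).image fun x => (x, y)) := by
    ext ⟨a, b⟩
    simp only [Finset.mem_filter, Finset.mem_insert, Finset.mem_image, Finset.mem_univ, true_and,
      Prod.mk.injEq, IsArc]
    constructor
    · rintro ⟨hab, rfl⟩
      by_cases ha : a = b
      · exact Or.inl ⟨ha, rfl⟩
      · exact Or.inr ⟨a, ⟨ha, hab⟩, rfl, rfl⟩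
    · rintro (⟨rfl, rfl⟩ | ⟨x, ⟨-, hx⟩, rfl, rfl⟩)
      · exact ⟨hy, rfl⟩
      · exact ⟨hx, rfl⟩
  rw [h1, Finset.card_insert_of_notMem, Finset.card_image_of_injective]
  · intro x x' h; exact (Prod.ext_iff.1 h).1
  · simp [IsArc]

/-- **A row of degree at least three has two distinct out-arcs.** [folklore] -/
theorem exists_two_isArc_of_three_le_card (x : Fin n) (hx : (x, x) ∈ G)
    (h3 : 3 ≤ (G.filter fun e => e.1 = x).card) :
    ∃ y₁ y₂, y₁ ≠ y₂ ∧ IsArc G x y₁ ∧ IsArc G x y₂ := by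
  have h2 : 1 < (Finset.univ.filter fun y => IsArc G x y).card := by
    have := card_filter_isArc_out x hx; omega
  obtain ⟨y₁, y₂, h₁, h₂, hne⟩ := Finset.one_lt_card_iff.1 h2
  exact ⟨y₁, y₂, hne, (mem_filter_isArc_iff x y₁).1 h₁, (mem_filter_isArc_iff x y₂).1 h₂⟩

/-- **Every out-arc of a row of degree at least three has a companion out-arc.** [folklore] -/
theorem exists_isArc_ne_of_three_le_card (x : Fin n) (hx : (x, x) ∈ G)
    (h3 : 3 ≤ (G.filter fun e => e.1 = x).card) (y : Fin n) :
    ∃ y', y' ≠ y ∧ IsArc G x y' := by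
  obtain ⟨y₁, y₂, hne, h₁, h₂⟩ := exists_two_isArc_of_three_le_card x hx h3
  by_cases h : y₁ = y
  · exact ⟨y₂, fun h' => hne (h.trans h'.symm), h₂⟩
  · exact ⟨y₁, h, h₁⟩

/-- **A column of degree at least three has two distinct in-arcs.** [folklore] -/
theorem exists_two_isArc_in_of_three_le_card (y : Fin n) (hy : (y, y) ∈ G)
    (h3 : 3 ≤ (G.filter fun e => e.2 = y).card) :
    ∃ x₁ x₂, x₁ ≠ x₂ ∧ IsArc G x₁ y ∧ IsArc G x₂ y := by
  have h2 : 1 < (Finset.univ.filter fun x => IsArc G x y).card := by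
    have := card_filter_isArc_in y hy; omega
  obtain ⟨x₁, x₂, h₁, h₂, hne⟩ := Finset.one_lt_card_iff.1 h2
  refine ⟨x₁, x₂, hne, ?_, ?_⟩
  · simpa using h₁
  · simpa using h₂

/-- **Every in-arc of a column of degree at least three has a companion in-arc.** [folklore] -/
theorem exists_isArc_in_ne_of_three_le_card (y : Fin n) (hy : (y, y) ∈ G)
    (h3 : 3 ≤ (G.filter fun e => e.2 = y).card) (x : Fin n) :
    ∃ x', x' ≠ x ∧ IsArc G x' y := by
  obtain ⟨x₁, x₂, hne, h₁, h₂⟩ := exists_two_isArc_in_of_three_le_card y hy h3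
  by_cases h : x₁ = x
  · exact ⟨x₂, fun h' => hne (h.trans h'.symm), h₂⟩
  · exact ⟨x₁, h, h₁⟩

end Digraph

end Literature.Combinatorics.SimpleGraph
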